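import Literature.Topology.FourManifolds.TrisectionsMidSectorFunction
import HarnessLib

/-!
# A boundary-adapted function on the middle sector `X₂` (Gay–Kirby 2016, Lemma 14), II:
# smoothness, the band regime and the regularity of the faces

Topic `Literature/Topology/FourManifolds`; infrastructure for the fact seat
`provefact-Literature.Topology.FourManifolds.exists_isBalancedGKTrisection` (Gay–Kirby 2016,
Thm. 4 via §4, Lemma 14).  Everything in this file is **proved**; no named facts are introduced.

For the function `ψ₂ = 1 - C Ψ₂`, `Ψ₂ = (-V)(-M̃) W R` of `TrisectionsMidSectorFunction.lean`
on the middle sector `X₂` of a `TriData` over a tube frame `𝔉` with parameters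
`𝔔 : 𝔉.MidParams`, this file proves the first half of the hypotheses of
`CornerSliceAtlas.hasHandleDecomposition_of_comp_val` (`TrisectionsSectorMorse.lean`):

* the boundary and interior points of the straightened `X₂` in terms of `F`, `F₁` and `M̃`
  (`TriData.isBoundaryPoint_iff₂'`, `TriData.isInteriorPoint_iff₂`);
* **smoothness of `Ψ₂` at every point of `X₂`** (`MidParams.contMDiffAt_PsiTwo`): `M̃` is
  smooth at the points which hit (`TriData.contMDiffAt_Mt_of_hit`) and equals `f - c` near the
  points which do not — these lie on the co-cores of the `2`-handles, in the thin tubes, where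
  the rounding is on its plateau (`TubeFrame.Mt_eventuallyEq_sub_of_P_lt`); the weight and
  the radial correction are smooth on the heights of `X₂` (`TrisectionsSectorWeight.lean`);
* **the band regime**: on the unit band `|s| < δ_U` the function `Ψ₂` strictly increases
  along the flow of the unit field (`MidParams.flowDeriv_PsiTwo_pos_band`: the flow
  derivative is `[(1 - err)(-M̃) - (-V) σ_ε'(w)] · W R`, positive by `|err| ≤ 1/4`,
  `-M̃ > c - f - 2ε` wherever `σ_ε' > 0`, `-V < s + δ_U` and `4δ_U + 2ε ≤ c - a`), so that
  `ψ₂` has no critical point at the interior band points (`not_isMCriticalPt_psiTwo_of_band`)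
  and is regular at the points of the bevel face `{F₁ = 0}` off `F`
  (`not_isMCriticalPt_psiTwo_of_F₁_eq_zero`);
* **regularity at the points of the face `{M̃ = 0}` off the bevel face**
  (`not_isMCriticalPt_psiTwo_of_Mt_eq_zero`: `ψ₂ = 1 - M̃ Λ₂` with `Λ₂ ≠ 0` and `M̃` a
  regular equation of the face).

## References

* D. Gay, R. Kirby, *Trisecting 4-manifolds*, Geom. Topol. 20 (2016), §4, Lemma 14. [GayKirby2016]
* J. Milnor, *Morse theory* (1963), Thm. 3.1 and §3. [Milnor1963]
* J. Milnor, *Lectures on the h-cobordism theorem* (1965), Def. 3.1, Thm. 3.12, Thm. 4.1. [MilnorHCobordism1965]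
-/

open scoped Manifold ContDiff Topology
open Set Function Filter

noncomputable section

universe u

namespace Literature.Topology.FourManifolds

open Flow

variable {X : Type u} [TopologicalSpace X] [T2Space X] [CompactSpace X]
  [ChartedSpace (EuclideanSpace ℝ (Fin 4)) X] [IsManifold (𝓡 4) ∞ X]

namespace BiCollar

namespace TriData

variable {B : BiCollar X} (T : B.TriData)

/-! ### Points of `X₂`: heights, signs, boundary and interior -/

/-- Points of `X₂` lie above `a - δ_U` (`F₁ ≥ 0` on `X₂` and the bevel term is below
`κ rOut₂ < δ_U`). [folklore] -/
theorem sFun_gt_of_mem_X₂ {x : X} (hx2 : x ∈ T.X₂) : -B.U.δ < B.sFun x := by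
  have h1 := T.F₁_nonneg_of_mem_X₂ hx2
  have h2 := T.D.bevel_term_le x
  have h3 := T.D.κ_mul_rOut₂_lt
  have h4 := T.D.rIn₁_lt
  have : T.D.F₁ x = B.sFun x + T.D.κ * T.D.θ x := rfl
  rw [this, BevelData.θ] at h1
  linarith

/-- At a point of `X₂` off the bevel face, `-V > 0`. [folklore] -/
theorem neg_faceV_pos_of_mem_X₂ (hc2 : B.a + B.U.δ + 2 * T.ε ≤ T.c) {x : X} (hx2 : x ∈ T.X₂)
    (h0 : T.D.F₁ x ≠ 0) : 0 < -T.D.faceV x := by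
  rw [T.faceV_eq_neg_F₁_of_mem_X₂ hc2 hx2, neg_neg]
  exact lt_of_le_of_ne (T.F₁_nonneg_of_mem_X₂ hx2) (Ne.symm h0)

/-- At a point of `X₂` off the face `{M̃ = 0}`, `-M̃ > 0`. [folklore] -/
theorem neg_Mt_pos_of_mem_X₂ {x : X} (hx2 : x ∈ T.X₂) (hM : T.Mt x ≠ 0) : 0 < -T.Mt x := by
  rcases (T.Mt_nonpos_of_mem_X₂ hx2).lt_or_eq with h | h
  · linarith
  · exact absurd h hM

/-- `-V ≤ s + κ rOut₂` everywhere. [folklore] -/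
theorem neg_faceV_le (x : X) : -T.D.faceV x ≤ B.sFun x + T.D.κ * T.D.χ₂.rOut := by
  rw [T.D.faceV_eq]
  have h1 : -(T.D.κ * (T.D.χ₁ (B.sFun x) * (T.D.χ₂ (B.rFun x) * B.rFun x))) ≤
      T.D.κ * (T.D.χ₁ (B.sFun x) * (T.D.χ₂ (B.rFun x) * |B.rFun x|)) := by
    have hχ₁ : 0 ≤ T.D.χ₁ (B.sFun x) := T.D.χ₁.nonneg
    have hχ₂ : 0 ≤ T.D.χ₂ (B.rFun x) := T.D.χ₂.nonneg
    have hr : -B.rFun x ≤ |B.rFun x| := neg_le_abs _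
    have hκ := T.D.κ_pos.le
    have : -(T.D.κ * (T.D.χ₁ (B.sFun x) * (T.D.χ₂ (B.rFun x) * B.rFun x))) =
        T.D.κ * (T.D.χ₁ (B.sFun x) * (T.D.χ₂ (B.rFun x) * (-B.rFun x))) := by ring
    rw [this]
    exact mul_le_mul_of_nonneg_left (mul_le_mul_of_nonneg_left
      (mul_le_mul_of_nonneg_left hr hχ₂) hχ₁) hκ
  have h2 := T.D.bevel_term_le x
  linarith

section Boundary

variable (hc2 : B.a + B.U.δ + 2 * T.ε ≤ T.c) {η : ℝ} (hη : 2 * T.ε ≤ η)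
  (hL : ∀ q : X, IsMCriticalPt (𝓡 4) B.f q → B.a < B.f q → B.f q ≤ T.c →
    ∀ y : B.Y, RegularLevel.incl B.hf y ∈ stableSet (𝓡 4) B.U.ξ q → B.g y < B.b - η)

/-- **The boundary points of the straightened `X₂`** are the points of `F`, of the bevel face
`{F₁ = 0}` and of `{M̃ = 0}` (the handlebody `H₂₃`). [cite: GayKirby2016, Def. 1 and §4, Lemma 14] -/
theorem isBoundaryPoint_iff₂' (p : T.X₂) :
    letI := (T.cornerSliceAtlas₂ hc2 hη hL).chartedSpace
    (𝓡∂ 4).IsBoundaryPoint p ↔ p.1 ∈ B.surface ∨ T.D.F₁ p.1 = 0 ∨ T.Mt p.1 = 0 := by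
  rw [T.isBoundaryPoint_iff₂ hc2 hη hL p]
  constructor
  · rintro (h | h | ⟨hh, hM⟩ | ⟨hh, hc⟩)
    · exact Or.inl h
    · exact Or.inr (Or.inl h)
    · exact Or.inr (Or.inr (by rw [T.Mt_of_hit hh]; exact hM))
    · exact Or.inr (Or.inr (by rw [T.Mt_of_not_hit hh]; linarith))
  · rintro (h | h | hM)
    · exact Or.inl h
    · exact Or.inr (Or.inl h)
    · by_cases hh : B.Hit p.1
      · exact Or.inr (Or.inr (Or.inl ⟨hh, by rwa [T.Mt_of_hit hh] at hM⟩))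
      · exact Or.inr (Or.inr (Or.inr ⟨hh, by rw [T.Mt_of_not_hit hh] at hM; linarith⟩))

/-- **The interior points of the straightened `X₂`** are the points off `F`, off the bevel
face and with `M̃ ≠ 0` (then `-V > 0` and `-M̃ > 0`). [cite: GayKirby2016, Def. 1 and §4, Lemma 14] -/
theorem isInteriorPoint_iff₂ (p : T.X₂) :
    letI := (T.cornerSliceAtlas₂ hc2 hη hL).chartedSpace
    (𝓡∂ 4).IsInteriorPoint p ↔ p.1 ∉ B.surface ∧ T.D.F₁ p.1 ≠ 0 ∧ T.Mt p.1 ≠ 0 := by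
  letI := (T.cornerSliceAtlas₂ hc2 hη hL).chartedSpace
  rw [(𝓡∂ 4).isInteriorPoint_iff_not_isBoundaryPoint, T.isBoundaryPoint_iff₂' hc2 hη hL]
  tauto

end Boundary

namespace TubeFrame

variable {T} {ι : Type} [Fintype ι] (𝔉 : T.TubeFrame ι)

/-- **Heights of the points of `X₂`**: `a - η₂ < f < a + 2η₂`. [folklore] -/
theorem f_bounds_of_mem_X₂ {x : X} (hx2 : x ∈ T.X₂) : B.a - 𝔉.η₂ < B.f x ∧ B.f x < B.a + 2 * 𝔉.η₂ := by
  have h1 := T.sFun_gt_of_mem_X₂ hx2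
  have h2 := T.f_le_c_of_mem_X₂ hx2
  have h3 := 𝔉.c_lt
  have h4 := 𝔉.band_le
  have : B.sFun x = B.f x - B.a := rfl
  constructor <;> linarith

/-- **At hitting points the lift of `g` along `ζ` is `G + b`.** [cite: MilnorHCobordism1965, Thm. 4.1] -/
theorem flowLift_eq_gFun_add {x : X} (hx : B.Hit x) : flowLift 𝔉.hζ B.hf B.g x = B.gFun x + B.b := by
  rw [flowLift_of_hits B.g ((𝔉.hit_iff x).1 hx), BiCollar.gFun]
  have h := 𝔉.incl_lamLift_eq hx
  have : (⟨levelProj 𝔉.hζ B.f B.a x, apply_levelProj 𝔉.hζ ((𝔉.hit_iff x).1 hx)⟩ : B.Y) = B.lamLift x :=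
    Subtype.ext h.symm
  rw [this]; ring

/-- **A point of `X₂`-height which does not hit lies on a co-core**: in some `source_j`, with
`A_j = 0`. [cite: MilnorHCobordism1965, Thm. 3.13] -/
theorem exists_A_eq_zero_of_not_hit {x : X} (hf₁ : B.a - 𝔉.η₂ < B.f x) (hf₂ : B.f x < B.a + 2 * 𝔉.η₂)
    (hx : ¬ B.Hit x) : ∃ j, x ∈ (𝔉.boxes.box j).chart.source ∧ 𝔉.boxes.A j x = 0 := by
  rcases 𝔉.boxes.hits_or_exists_A_eq_zero (hξ := 𝔉.hζ) 𝔉.hgl T.Fr.isMorse hf₁ hf₂ with hh | ⟨j, hbox, hA⟩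
  · exact absurd ((𝔉.hit_iff x).2 hh) hx
  · exact ⟨j, hbox.1, hA⟩

/-- **Near a point of a thin tube at `X₂`-height, `M̃ = f - c`**, given the plateau inequality
`η₂ + ν² + ε + δ_U ≤ m₀`: nearby points which hit land with `G ≤ -m₀`, so `w ≥ ε` and the
rounding is on its plateau; points which do not hit have `M̃ = f - c` by definition. [cite: GayKirby2016, §4, Lemma 14] -/
theorem Mt_eventuallyEq_sub_of_P_lt (hpl : 𝔉.η₂ + 𝔉.ν ^ 2 + T.ε + B.U.δ ≤ 𝔉.m₀) {j : ι} {x : X}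
    (hsrc : x ∈ (𝔉.boxes.box j).chart.source) (hP : 𝔉.boxes.P j x < 𝔉.P₀)
    (hf₁ : B.a - B.U.δ < B.f x) (hf₂ : B.f x < B.a + 2 * 𝔉.η₂) :
    T.Mt =ᶠ[𝓝 x] fun y => B.f y - T.c := by
  have hPc : ContinuousAt (𝔉.boxes.P j) x :=
    (𝔉.boxes.continuousOn_P j).continuousAt ((𝔉.boxes.box j).chart.open_source.mem_nhds hsrc)
  have hfc : Continuous B.f := B.U.contMDiff_f.continuous
  filter_upwards [(𝔉.boxes.box j).chart.open_source.mem_nhds hsrc, hPc.eventually (Iio_mem_nhds hP),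
    hfc.continuousAt.eventually (Ioo_mem_nhds hf₁ hf₂)] with y hy hyP hyf
  by_cases hh : B.Hit y
  · rw [T.Mt_of_hit hh]
    apply T.M_eq_sub_of_le_w
    have hG := 𝔉.gFun_le_of_P_lt hy hyP (by linarith [𝔉.band_le, hyf.1]) hyf.2 hh
    show T.ε ≤ B.f y - T.c - B.gFun y
    rw [𝔉.c_eq]; linarith [hyf.1]
  · exact T.Mt_of_not_hit hh

/-- `M̃` is smooth at such points. [folklore] -/
theorem contMDiffAt_Mt_of_P_lt (hpl : 𝔉.η₂ + 𝔉.ν ^ 2 + T.ε + B.U.δ ≤ 𝔉.m₀) {j : ι} {x : X}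
    (hsrc : x ∈ (𝔉.boxes.box j).chart.source) (hP : 𝔉.boxes.P j x < 𝔉.P₀)
    (hf₁ : B.a - B.U.δ < B.f x) (hf₂ : B.f x < B.a + 2 * 𝔉.η₂) :
    ContMDiffAt (𝓡 4) 𝓘(ℝ, ℝ) ∞ T.Mt x :=
  (B.U.contMDiff_f.contMDiffAt.sub contMDiffAt_const).congr_of_eventuallyEq
    (𝔉.Mt_eventuallyEq_sub_of_P_lt hpl hsrc hP hf₁ hf₂)

namespace MidParams

variable {𝔉} (𝔔 : 𝔉.MidParams)

/-! ### Smoothness of `Ψ₂` on `X₂` -/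

include 𝔔 in
/-- **`M̃` is smooth at every point of `X₂`.** [folklore] -/
theorem contMDiffAt_Mt {x : X} (hx2 : x ∈ T.X₂) : ContMDiffAt (𝓡 4) 𝓘(ℝ, ℝ) ∞ T.Mt x := by
  by_cases hh : B.Hit x
  · exact T.contMDiffAt_Mt_of_hit hh
  · obtain ⟨hf₁, hf₂⟩ := 𝔉.f_bounds_of_mem_X₂ hx2
    obtain ⟨j, hsrc, hA⟩ := 𝔉.exists_A_eq_zero_of_not_hit hf₁ hf₂ hh
    have hP : 𝔉.boxes.P j x < 𝔉.P₀ := by rw [HandleBoxes.P_def, hA, zero_mul]; exact 𝔉.P₀_pos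
    have hs := T.sFun_gt_of_mem_X₂ hx2
    have : B.sFun x = B.f x - B.a := rfl
    exact 𝔉.contMDiffAt_Mt_of_P_lt 𝔔.plateau hsrc hP (by linarith) hf₂

/-- **The weight is smooth at the heights of `X₂`.** [cite: GayKirby2016, §4, Lemma 14] -/
theorem contMDiffAt_W {x : X} (hf₁ : B.a - 𝔉.η₂ < B.f x) (hf₂ : B.f x < B.a + 2 * 𝔉.η₂) :
    ContMDiffAt (𝓡 4) 𝓘(ℝ, ℝ) ∞ 𝔔.W x := by
  unfold W
  exact 𝔉.boxes.contMDiffAt_weight (hξ := 𝔉.hζ) 𝔉.hgl T.Fr.isMorse B.V.contMDiff_f 𝔔.w_contDiff 𝔔.ρ_contDiff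
    𝔉.εT_nonneg 𝔉.κT_pos.le 𝔔.aR_pos 𝔔.two_aR_le (fun A hA _ => 𝔔.ρ_eq_inv A hA) 𝔔.hκδ
    (fun j y hy ht => 𝔔.g_form j y hy ht) hf₁ hf₂

omit [CompactSpace X] in
/-- **The radial correction is smooth at the heights of `X₂`.** [folklore] -/
theorem contMDiffAt_Rad {x : X} (hf₂ : B.f x < B.a + 2 * 𝔉.η₂) : ContMDiffAt (𝓡 4) 𝓘(ℝ, ℝ) ∞ 𝔔.Rad x := by
  unfold Rad
  exact 𝔉.boxes.contMDiffAt_radial T.Fr.isMorse 𝔔.R₀_contDiff (𝔔.aR'_lt.le.trans 𝔔.aR_le) 𝔔.R₀_eq_one hf₂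

/-- **`Ψ₂` is smooth at every point of `X₂`.** [cite: GayKirby2016, §4, Lemma 14] -/
theorem contMDiffAt_PsiTwo {x : X} (hx2 : x ∈ T.X₂) : ContMDiffAt (𝓡 4) 𝓘(ℝ, ℝ) ∞ 𝔔.PsiTwo x := by
  obtain ⟨hf₁, hf₂⟩ := 𝔉.f_bounds_of_mem_X₂ hx2
  have h1 : ContMDiffAt (𝓡 4) 𝓘(ℝ, ℝ) ∞ (fun y => -T.D.faceV y) x :=
    contMDiffAt_const.sub (T.D.contMDiff_faceV x) |>.congr_of_eventuallyEq
      (Eventually.of_forall fun y => (zero_sub _).symm)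
  have h2 : ContMDiffAt (𝓡 4) 𝓘(ℝ, ℝ) ∞ (fun y => -T.Mt y) x :=
    contMDiffAt_const.sub (𝔔.contMDiffAt_Mt hx2) |>.congr_of_eventuallyEq
      (Eventually.of_forall fun y => (zero_sub _).symm)
  exact ((h1.mul h2).mul (𝔔.contMDiffAt_W hf₁ hf₂)).mul (𝔔.contMDiffAt_Rad hf₂)

/-- **`ψ₂` is smooth at every point of `X₂`.** [cite: GayKirby2016, §4, Lemma 14] -/
theorem contMDiffAt_psiTwo {x : X} (hx2 : x ∈ T.X₂) : ContMDiffAt (𝓡 4) 𝓘(ℝ, ℝ) ∞ 𝔔.psiTwo x :=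
  contMDiffAt_const.sub (contMDiffAt_const.mul (𝔔.contMDiffAt_PsiTwo hx2))

/-! ### The band: `W = w(G + b)` and `R = 1` nearby -/

include 𝔔 in
/-- The error bounds of the flow derivatives of the face functions: `-1/4 ≤ err ≤ 1/4`. [folklore] -/
theorem err_bounds (x : X) : -(1 / 4) ≤ T.D.err x ∧ T.D.err x ≤ 1 / 4 := by
  have h1 : |T.D.χ₂ (B.rFun x) * B.rFun x| ≤ T.D.χ₂.rOut := by
    rw [abs_mul, abs_of_nonneg T.D.χ₂.nonneg]; exact T.D.χ₂_mul_abs_le _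
  have h2 := 𝔔.abs_deriv_le (B.sFun x)
  have hL0 : 0 ≤ 𝔔.L := (abs_nonneg _).trans (𝔔.abs_deriv_le 0)
  have h : |T.D.err x| ≤ 1 / 4 := by
    rw [BevelData.err, abs_mul, abs_mul, abs_of_pos T.D.κ_pos]
    calc T.D.κ * (|deriv T.D.χ₁ (B.sFun x)| * |T.D.χ₂ (B.rFun x) * B.rFun x|) ≤ T.D.κ * (𝔔.L * T.D.χ₂.rOut) := by
          apply mul_le_mul_of_nonneg_left _ T.D.κ_pos.le
          exact mul_le_mul h2 h1 (abs_nonneg _) hL0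
      _ ≤ 1 / 4 := by rw [← mul_assoc]; exact 𝔔.hκ
  exact abs_le.1 h

omit [T2Space X] [CompactSpace X] in
/-- A band point lies below the closure of the zones: `f < a + η₂ - a_R`. [folklore] -/
theorem f_lt_of_band {p : X} (hp : |B.sFun p| < B.U.δ) : B.f p < B.a + 𝔉.η₂ - 𝔔.aR := by
  have := (abs_lt.1 hp).2; have := 𝔔.band_aR; have := 𝔔.aR_pos
  have hs : B.sFun p = B.f p - B.a := rfl
  linarith

omit [T2Space X] [CompactSpace X] in
/-- Points with `f < a + η₂ - a_R` lie in no chart zone `{A_j < a_R}`. [folklore] -/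
theorem not_mem_zone_of_f_lt {y : X} (hy : B.f y < B.a + 𝔉.η₂ - 𝔔.aR) (j : ι) : y ∉ 𝔉.boxes.zone 𝔔.aR j :=
  fun hz => by
    have h1 := 𝔉.boxes.apply_eq hz.1
    have h2 := hz.2
    have h3 := 𝔉.boxes.B_nonneg j y
    linarith

omit [T2Space X] [CompactSpace X] in
/-- Points with `f < a + η₂ - a_R` in `source_j` have `A_j > a_R'`. [folklore] -/
theorem aR'_lt_A_of_f_lt {y : X} (hy : B.f y < B.a + 𝔉.η₂ - 𝔔.aR) {j : ι} (hj : y ∈ (𝔉.boxes.box j).chart.source) :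
    𝔔.aR' < 𝔉.boxes.A j y := by
  have h1 := 𝔉.boxes.apply_eq hj
  have h3 := 𝔉.boxes.B_nonneg j y
  have h4 := 𝔔.aR'_lt
  linarith

/-- **Near a band point, `W = w(G + b)`.** [cite: GayKirby2016, §4, Lemma 14] -/
theorem W_eventuallyEq_of_band {p : X} (hp : |B.sFun p| < B.U.δ) :
    𝔔.W =ᶠ[𝓝 p] fun y => 𝔔.w (B.gFun y + B.b) := by
  have hfp := 𝔔.f_lt_of_band hp
  have hhit : B.Hit p := B.hit_of_mem_band (B.mem_band_U hp)
  filter_upwards [(isOpen_lt B.U.contMDiff_f.continuous continuous_const).mem_nhds hfp,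
    T.Fr.isOpen_setOf_hit.mem_nhds hhit] with y hy hyh
  unfold W
  rw [𝔉.boxes.weight_of_forall_not_mem (𝔔.not_mem_zone_of_f_lt hy), 𝔉.flowLift_eq_gFun_add hyh]

omit [T2Space X] [CompactSpace X] in
/-- **Near a band point, `R = 1`.** [folklore] -/
theorem Rad_eventuallyEq_one_of_band {p : X} (hp : |B.sFun p| < B.U.δ) : 𝔔.Rad =ᶠ[𝓝 p] fun _ => 1 := by
  have hfp := 𝔔.f_lt_of_band hp
  filter_upwards [(isOpen_lt B.U.contMDiff_f.continuous continuous_const).mem_nhds hfp] with y hy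
  unfold Rad
  exact 𝔉.boxes.radial_eq_one_of_le 𝔔.R₀_eq_one fun j hj => (𝔔.aR'_lt_A_of_f_lt hy hj).le

/-- At a band point, `W = w(G + b)` and `R = 1`. [folklore] -/
theorem W_of_band {p : X} (hp : |B.sFun p| < B.U.δ) : 𝔔.W p = 𝔔.w (B.gFun p + B.b) :=
  (𝔔.W_eventuallyEq_of_band hp).self_of_nhds

omit [T2Space X] [CompactSpace X] in
/-- At a band point, `R = 1`. [folklore] -/
theorem Rad_of_band {p : X} (hp : |B.sFun p| < B.U.δ) : 𝔔.Rad p = 1 :=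
  (𝔔.Rad_eventuallyEq_one_of_band hp).self_of_nhds

/-! ### Flow derivatives on the band -/

section FlowDeriv

variable {p : X} (hp : |B.sFun p| < B.U.δ)

omit [T2Space X] [CompactSpace X] in
include hp in
/-- On the band, `ξ(f) = 1`. [folklore] -/
theorem _root_.Literature.Topology.FourManifolds.BiCollar.mlineDeriv_eq_one_of_band :
    mlineDeriv (𝓡 4) B.f p (B.U.ξ p) = 1 :=
  B.U.mlineDeriv_eq_one p (by
    have h := abs_lt.1 hp
    have hs : B.sFun p = B.f p - B.a := rfl
    constructor <;> linarith [h.1, h.2])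

include hp in
/-- **`W` is constant along the flow near `0` at a band point.** [folklore] -/
theorem hasDerivAt_W_fl_band : HasDerivAt (fun t => 𝔔.W (B.U.fl p t)) 0 0 := by
  have hhit : B.Hit p := B.hit_of_mem_band (B.mem_band_U hp)
  have hc : ContinuousAt (fun t => B.U.fl p t) 0 := (B.contMDiff_fl_right p).continuous.continuousAt
  have h := 𝔔.W_eventuallyEq_of_band hp
  rw [← B.U.fl_zero p] at h
  have hev : (fun t => 𝔔.W (B.U.fl p t)) =ᶠ[𝓝 0] fun _ => 𝔔.w (B.gFun p + B.b) := by
    filter_upwards [hc.eventually h] with t ht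
    rw [ht, T.Fr.gFun_fl hhit t]
  exact (hasDerivAt_const (0 : ℝ) (𝔔.w (B.gFun p + B.b))).congr_of_eventuallyEq hev

include hp in
/-- **`R` is constant along the flow near `0` at a band point.** [folklore] -/
theorem hasDerivAt_Rad_fl_band : HasDerivAt (fun t => 𝔔.Rad (B.U.fl p t)) 0 0 := by
  have hc : ContinuousAt (fun t => B.U.fl p t) 0 := (B.contMDiff_fl_right p).continuous.continuousAt
  have h := 𝔔.Rad_eventuallyEq_one_of_band hp
  rw [← B.U.fl_zero p] at h
  have hev : (fun t => 𝔔.Rad (B.U.fl p t)) =ᶠ[𝓝 0] fun _ => (1 : ℝ) := by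
    filter_upwards [hc.eventually h] with t ht
    exact ht
  exact (hasDerivAt_const (0 : ℝ) (1 : ℝ)).congr_of_eventuallyEq hev

include hp in
/-- **The flow derivative of `Ψ₂` at a band point**:
`[(1 - err)(-M̃) + (-V)(-σ_ε'(w))] · (W R)`. [cite: GayKirby2016, §4, Lemma 14] -/
theorem hasDerivAt_PsiTwo_fl_band :
    HasDerivAt (fun t => 𝔔.PsiTwo (B.U.fl p t))
      (((1 - T.D.err p) * (-T.Mt p) + (-T.D.faceV p) * (-creaseStep (T.w p / T.ε))) * (𝔔.W p * 𝔔.Rad p)) 0 := by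
  have hhit : B.Hit p := B.hit_of_mem_band (B.mem_band_U hp)
  have hV : HasDerivAt (fun t => -T.D.faceV (B.U.fl p t)) (-(-1 + T.D.err p)) 0 :=
    (T.D.hasDerivAt_faceV_fl hp).neg
  have hM := T.hasDerivAt_Mt_fl_of_hit hhit
  rw [B.mlineDeriv_eq_one_of_band hp, mul_one] at hM
  have hM' : HasDerivAt (fun t => -T.Mt (B.U.fl p t)) (-creaseStep (T.w p / T.ε)) 0 := hM.neg
  have hW := 𝔔.hasDerivAt_W_fl_band hp
  have hR := 𝔔.hasDerivAt_Rad_fl_band hp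
  have h := ((hV.mul hM').mul hW).mul hR
  have hfun : (fun t => 𝔔.PsiTwo (B.U.fl p t)) =
      fun t => (-T.D.faceV (B.U.fl p t)) * (-T.Mt (B.U.fl p t)) * 𝔔.W (B.U.fl p t) * 𝔔.Rad (B.U.fl p t) := by
    funext t; rfl
  rw [hfun]
  refine h.congr_deriv ?_
  simp only [B.U.fl_zero]
  ring

include hp in
/-- **`Ψ₂` strictly increases along the flow at the interior band points of `X₂`.**  Write
the flow derivative as `[(1 - err)(-M̃) - (-V) σ'] W R` with `σ' = σ_ε'(w) ∈ [0, 1]`,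
`|err| ≤ 1/4`, `-M̃ > 0`, `0 < -V ≤ s + κ rOut₂ < s + δ_U`.  If `σ' = 0` the bracket is
`≥ (3/4)(-M̃) > 0`.  If `σ' > 0` then `w > -ε`, i.e. `G < f - c + ε`, so
`M ≤ max(G, f - c) + ε < f - c + 2ε` and `-M̃ > c - f - 2ε`; hence the bracket exceeds
`(3/4)(c - f - 2ε) - (s + δ_U) > (3/4)(c - a - δ_U - 2ε) - 2δ_U ≥ 0` by `s < δ_U` and
`4δ_U + 2ε ≤ c - a`. [cite: GayKirby2016, §4, Lemma 14] -/
theorem flowDeriv_PsiTwo_pos_band (hx2 : p ∈ T.X₂) (h0 : T.D.F₁ p ≠ 0) (hM : T.Mt p ≠ 0) :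
    0 < ((1 - T.D.err p) * (-T.Mt p) + (-T.D.faceV p) * (-creaseStep (T.w p / T.ε))) * (𝔔.W p * 𝔔.Rad p) := by
  have hhit : B.Hit p := B.hit_of_mem_band (B.mem_band_U hp)
  have hWR : 0 < 𝔔.W p * 𝔔.Rad p := mul_pos (𝔔.W_pos p) (𝔔.Rad_pos p)
  refine mul_pos ?_ hWR
  have hV : 0 < -T.D.faceV p := T.neg_faceV_pos_of_mem_X₂ 𝔔.hc2 hx2 h0
  have hMt : 0 < -T.Mt p := T.neg_Mt_pos_of_mem_X₂ hx2 hM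
  have herr := 𝔔.err_bounds p
  have h3 : 3 / 4 * (-T.Mt p) ≤ (1 - T.D.err p) * (-T.Mt p) :=
    mul_le_mul_of_nonneg_right (by linarith [herr.2]) hMt.le
  set σ' := creaseStep (T.w p / T.ε) with hσ'
  have hσ'0 : 0 ≤ σ' := creaseStep_nonneg _
  have hσ'1 : σ' ≤ 1 := creaseStep_le_one _
  rcases hσ'0.eq_or_lt with hzero | hpos
  · -- `σ' = 0`
    rw [← hzero]
    nlinarith
  · -- `σ' > 0`: `w > -ε`
    have hw : -T.ε < T.w p := by
      by_contra hle
      push Not at hle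
      have : T.w p / T.ε ≤ -1 := by
        rw [div_le_iff₀ T.ε_pos]; linarith
      have h0' : σ' = 0 := creaseStep_of_le_neg_one this
      linarith
    have hwdef : T.w p = B.f p - T.c - B.gFun p := rfl
    have hMle := T.M_le p
    have hMeq : T.Mt p = T.M p := T.Mt_of_hit hhit
    have hmax : max (B.gFun p) (B.f p - T.c) < B.f p - T.c + T.ε :=
      max_lt (by linarith) (by linarith [T.ε_pos])
    have hMbig : T.c - B.f p - 2 * T.ε < -T.Mt p := by rw [hMeq]; linarith
    have hVle := T.neg_faceV_le p
    have hκr : T.D.κ * T.D.χ₂.rOut < B.U.δ := T.D.κ_mul_rOut₂_lt.trans T.D.rIn₁_lt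
    have hs : B.sFun p < B.U.δ := (abs_lt.1 hp).2
    have hsdef : B.sFun p = B.f p - B.a := rfl
    have h4 := 𝔔.band4
    have h5 : -T.D.faceV p * σ' ≤ -T.D.faceV p := mul_le_of_le_one_right hV.le hσ'1
    nlinarith

include hp in
/-- **`Ψ₂` has no critical point at the interior band points of `X₂`.** [cite: GayKirby2016, §4, Lemma 14] -/
theorem not_isMCriticalPt_PsiTwo_of_band (hx2 : p ∈ T.X₂) (h0 : T.D.F₁ p ≠ 0) (hM : T.Mt p ≠ 0) :
    ¬ IsMCriticalPt (𝓡 4) 𝔔.PsiTwo p :=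
  not_isMCriticalPt_of_hasDerivAt_comp ((𝔔.contMDiffAt_PsiTwo hx2).mdifferentiableAt (by simp))
    (B.U.fl_zero p) ((B.contMDiff_fl_right p).mdifferentiableAt (by simp)) (𝔔.hasDerivAt_PsiTwo_fl_band hp)
    (𝔔.flowDeriv_PsiTwo_pos_band hp hx2 h0 hM).ne'

include hp in
/-- **`ψ₂` has no critical point at the interior band points of `X₂`.** [cite: GayKirby2016, §4, Lemma 14] -/
theorem not_isMCriticalPt_psiTwo_of_band (hx2 : p ∈ T.X₂) (h0 : T.D.F₁ p ≠ 0) (hM : T.Mt p ≠ 0) :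
    ¬ IsMCriticalPt (𝓡 4) 𝔔.psiTwo p := by
  have hd := ((𝔔.hasDerivAt_PsiTwo_fl_band hp).const_mul 𝔔.C).const_sub 1
  refine not_isMCriticalPt_of_hasDerivAt_comp ((𝔔.contMDiffAt_psiTwo hx2).mdifferentiableAt (by simp))
    (B.U.fl_zero p) ((B.contMDiff_fl_right p).mdifferentiableAt (by simp)) hd ?_
  have := 𝔔.flowDeriv_PsiTwo_pos_band hp hx2 h0 hM
  have := 𝔔.C_pos
  intro h
  nlinarith

end FlowDeriv

/-! ### Regularity of the bevel face `{F₁ = 0}` off `F` -/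

/-- **`ψ₂` is regular at the points of the bevel face off `F`**: such a point lies on the
band, `V = 0` there, and the flow derivative of `Ψ₂` is `(1 - err)(-M̃) W R > 0`
(`M̃ = M = r < 0`). [cite: GayKirby2016, §4, Lemma 14] -/
theorem not_isMCriticalPt_psiTwo_of_F₁_eq_zero {p : X} (hx2 : p ∈ T.X₂) (h0 : T.D.F₁ p = 0)
    (hpF : p ∉ B.surface) : ¬ IsMCriticalPt (𝓡 4) 𝔔.psiTwo p := by
  have hp : |B.sFun p| < B.U.δ := (T.D.abs_sFun_lt_rIn_of_F₁_eq_zero h0).trans T.D.rIn₁_lt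
  have hxb : p ∈ B.U.band := B.mem_band_U hp
  have hhit : B.Hit p := B.hit_of_mem_band hxb
  have hV0 : T.D.faceV p = 0 := by rw [T.faceV_eq_neg_F₁_of_mem_X₂ 𝔔.hc2 hx2, h0, neg_zero]
  have hr : B.rFun p < 0 := T.rFun_neg_of_mem_X₂ 𝔔.hc2 hx2 h0 hpF
  have hMneg : T.Mt p < 0 := by
    rw [T.Mt_of_hit hhit]; exact (T.M_neg_iff_of_mem_band 𝔔.hc2 hxb).2 hr
  have hd := ((𝔔.hasDerivAt_PsiTwo_fl_band hp).const_mul 𝔔.C).const_sub 1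
  refine not_isMCriticalPt_of_hasDerivAt_comp ((𝔔.contMDiffAt_psiTwo hx2).mdifferentiableAt (by simp))
    (B.U.fl_zero p) ((B.contMDiff_fl_right p).mdifferentiableAt (by simp)) hd ?_
  rw [hV0, neg_zero, zero_mul, add_zero]
  have herr := 𝔔.err_bounds p
  have h1 : 0 < 1 - T.D.err p := by linarith [herr.2]
  have h2 : 0 < -T.Mt p := by linarith
  have := 𝔔.C_pos
  have := 𝔔.W_pos p
  have := 𝔔.Rad_pos p
  have hpos : 0 < (1 - T.D.err p) * (-T.Mt p) * (𝔔.W p * 𝔔.Rad p) := by positivity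
  intro h
  nlinarith

/-! ### Regularity of the face `{M̃ = 0}` off the bevel face -/

/-- **The cofactor of `M̃`**: `Λ₂ = C · V · W · R`, so that `ψ₂ = 1 - M̃ Λ₂`. [folklore] -/
def Lam₂ (y : X) : ℝ := 𝔔.C * T.D.faceV y * 𝔔.W y * 𝔔.Rad y

/-- `ψ₂ = 1 - M̃ Λ₂`. [folklore] -/
theorem psiTwo_eq : 𝔔.psiTwo = fun y => 1 - T.Mt y * 𝔔.Lam₂ y := by
  funext y
  simp only [psiTwo, PsiTwo, Lam₂]
  ring

/-- `Λ₂` is smooth at every point of `X₂`. [folklore] -/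
theorem contMDiffAt_Lam₂ {x : X} (hx2 : x ∈ T.X₂) : ContMDiffAt (𝓡 4) 𝓘(ℝ, ℝ) ∞ 𝔔.Lam₂ x := by
  obtain ⟨hf₁, hf₂⟩ := 𝔉.f_bounds_of_mem_X₂ hx2
  unfold Lam₂
  exact ((contMDiffAt_const.mul (T.D.contMDiff_faceV x)).mul (𝔔.contMDiffAt_W hf₁ hf₂)).mul (𝔔.contMDiffAt_Rad hf₂)

/-- `Λ₂ < 0` off the bevel face. [folklore] -/
theorem Lam₂_neg {x : X} (hx2 : x ∈ T.X₂) (h0 : T.D.F₁ x ≠ 0) : 𝔔.Lam₂ x < 0 := by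
  have hV : 0 < -T.D.faceV x := T.neg_faceV_pos_of_mem_X₂ 𝔔.hc2 hx2 h0
  have h1 : 0 < 𝔔.C * (-T.D.faceV x) * 𝔔.W x * 𝔔.Rad x :=
    mul_pos (mul_pos (mul_pos 𝔔.C_pos hV) (𝔔.W_pos x)) (𝔔.Rad_pos x)
  unfold Lam₂; linarith [show 𝔔.C * (-T.D.faceV x) * 𝔔.W x * 𝔔.Rad x =
    -(𝔔.C * T.D.faceV x * 𝔔.W x * 𝔔.Rad x) by ring]

/-- **`ψ₂` is regular at the points of `{M̃ = 0}` off the bevel face**: near such a point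
`ψ₂ = 1 - F Λ₂` for a smooth `F` equal to `M̃` near the point with a regular zero there (the
straightening function of `M` if the point hits — `TriData.strFun` —, `f - c` if not), and
`Λ₂ ≠ 0`. [cite: GayKirby2016, §4, Lemma 14] -/
theorem not_isMCriticalPt_psiTwo_of_Mt_eq_zero {p : X} (hx2 : p ∈ T.X₂) (h0 : T.D.F₁ p ≠ 0) (hM : T.Mt p = 0) :
    ¬ IsMCriticalPt (𝓡 4) 𝔔.psiTwo p := by
  have hΛ := 𝔔.Lam₂_neg hx2 h0
  have hΛd : MDifferentiableAt (𝓡 4) 𝓘(ℝ, ℝ) 𝔔.Lam₂ p := (𝔔.contMDiffAt_Lam₂ hx2).mdifferentiableAt (by simp)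
  rw [𝔔.psiTwo_eq]
  by_cases hh : B.Hit p
  · have hM0 : T.M p = 0 := by rwa [T.Mt_of_hit hh] at hM
    set F := T.strFun hh hM0 with hFdef
    have hev : (fun y => 1 - T.Mt y * 𝔔.Lam₂ y) =ᶠ[𝓝 p] fun y => (1 - F y * 𝔔.Lam₂ y) + 0 := by
      filter_upwards [T.strFun_eventuallyEq hh hM0, T.Mt_eventuallyEq_M hh] with y hy hy'
      rw [hy', ← hy, add_zero]
    rw [isMCriticalPt_congr_of_eventuallyEq_add_const hev]
    exact not_isMCriticalPt_one_sub_mul ((T.contMDiff_strFun hh hM0).mdifferentiableAt (by simp)) hΛd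
      (by rw [hFdef, (T.strFun_eventuallyEq hh hM0).eq_of_nhds]; exact hM0) hΛ.ne (T.not_isMCriticalPt_strFun hh hM0)
  · have hfc : B.f p = T.c := by rw [T.Mt_of_not_hit hh] at hM; linarith
    obtain ⟨hf₁, hf₂⟩ := 𝔉.f_bounds_of_mem_X₂ hx2
    obtain ⟨j, hsrc, hA⟩ := 𝔉.exists_A_eq_zero_of_not_hit hf₁ hf₂ hh
    have hP : 𝔉.boxes.P j p < 𝔉.P₀ := by rw [HandleBoxes.P_def, hA, zero_mul]; exact 𝔉.P₀_pos
    have hs := T.sFun_gt_of_mem_X₂ hx2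
    have hsdef : B.sFun p = B.f p - B.a := rfl
    have hev0 := 𝔉.Mt_eventuallyEq_sub_of_P_lt 𝔔.plateau hsrc hP (by linarith) hf₂
    have hev : (fun y => 1 - T.Mt y * 𝔔.Lam₂ y) =ᶠ[𝓝 p] fun y => (1 - (B.f y - T.c) * 𝔔.Lam₂ y) + 0 := by
      filter_upwards [hev0] with y hy
      rw [hy, add_zero]
    rw [isMCriticalPt_congr_of_eventuallyEq_add_const hev]
    have hfd : MDifferentiableAt (𝓡 4) 𝓘(ℝ, ℝ) (fun y => B.f y - T.c) p :=
      (B.U.contMDiff_f.contMDiffAt.sub contMDiffAt_const).mdifferentiableAt (by simp)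
    refine not_isMCriticalPt_one_sub_mul hfd hΛd (by show B.f p - T.c = 0; linarith) hΛ.ne ?_
    -- `f - c` is regular at `p` since `c` is a regular value
    intro hc
    apply T.regular_c p hfc
    have h := (isMCriticalPt_const_mul_add_iff (I := 𝓡 4) (f := B.f) one_ne_zero (-T.c) (x := p)
      (B.U.contMDiff_f.mdifferentiableAt (by simp))).1
    apply h
    have : (fun y => 1 * B.f y + -T.c) = fun y => B.f y - T.c := by funext y; ring
    rw [this]; exact hc

end MidParams

end TubeFrame

end TriData

end BiCollar

end Literature.Topology.FourManifolds

end
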